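import Summits.Parity.GeneralizedHardyLittlewood.Theorems.LeeYangFibresPrimeCellsRelativeChowlaDefs
import Summits.Parity.GeneralizedHardyLittlewood.Theorems.LeeYangFibresPrimeCellsRelativeSieveTransferSigned
import Summits.Parity.GeneralizedHardyLittlewood.Theorems.LeeYangFibresPrimeCellsRelativeSieveTransferTools
import Summits.Parity.GeneralizedHardyLittlewood.Theorems.LeeYangFibresCellParityLawSingularRatio
import Literature.NumberTheory.Sieve.LinearEquationsInPrimesSingularSeries
import Literature.NumberTheory.Sieve.SieveFrameworkFundamentalLemma
import HarnessLib

/-!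
# Route `LeeYangFibres`, crux `PrimeCellsRelative` (stmt-Parity-14112), line `SketchIdeator4`
# (card `sieve-out-to-chowla`): the registered stub `stub_sieveTransfer` — sieving OUT a signed sequence off
# the rough tuples of a one-dimensional system

`SieveTransfer` (vocabulary file `Theorems/LeeYangFibresPrimeCellsRelativeChowlaDefs.lean`): for every `t, L` there is
`C = C(t, L) ≥ 0` such that for `s ≥ 1`, `u ≥ 4s`, `N ≥ N₀(t, L, s, u)`, every non-degenerate `Ψ` of size `≤ L`, every
convex `K ⊆ [−N, N]` and every `±1` weight `σ` on `ℤ`,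
`|Σ_{n ∈ roughTuples} σ(n₀)| ≤ C e^{−s} β_∞∏β_p (u/log N)^t + Σ_{d ≤ N^{2s/u} sqfree} Σ_{r mod d, d ∣ F_Ψ(r)}
|Σ_{m ∈ I, m ≡ r (d)} σ(m)| + N/(log N)^{t+1}`, `I = [m₁, m₂]` the lattice points of `K ∩ {Ψ ≥ 1}`.

Assembly of landed pieces: the interval `I` (`interval_of_convex`), rough tuples ↔ rough points of `I`
(`sum_roughTuples_eq_sum_filter`, any weight) ↔ sifted points (`abs_sum_rough_sub_sum_coprime_le`, cost `≤ t`); a local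
obstruction `ω_F(p) = p` (then `p ≤ L + t ≤ N^{1/u}`) empties the rough tuples, otherwise the root density of `F_Ψ` has
dimension `2(L+t)` (`hasSieveDimension_sysPoly`) and the signed sifted sum is bounded by helper file 1
(`signed_sifted_sum_le_of_sign'`, level `D = z^s`, `z = ⌊N^{1/u}⌋ + 1`, so `e^{−log D/log z} = e^{−s}`); the main term
`C_FL #I V(z) e^{−s}` is `≤ 2 C_FL e^{−s} β_∞∏β_p (u/log N)^t + C_FL` (`sieveProduct_floor_succ_le`); the moduli
`d ≤ z^s ≤ N^{2s/u} ≤ N^{1/2}` (`level_facts`) carry `Σ_d ω_F(d) ≤ N^{1/2} e^{10(L+t)} (log N)^{2(L+t)}` unit boundary terms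
(`sum_card_rootsMod_le`), absorbed with `t + C_FL` into `N/(log N)^{t+1}` (`eventually_junk_half`).

References: Friedlander–Iwaniec, *Opera de Cribro* (2010), Cor. 6.10 [FriedlanderIwaniecOpera2010]; Halberstam–Richert,
*Sieve Methods* (1974), Thm 2.5, §5.7 [HalberstamRichert1974]; Green–Tao 2010, (1.6)–(1.7) [GreenTao2010].
-/

noncomputable section

open Finset Filter Polynomial ArithmeticFunction
open scoped ArithmeticFunction.omega Classical

namespace Summit.Parity.GeneralizedHardyLittlewood.Cruxes.PrimeCellsRelative.SieveOutToChowla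

open Literature.NumberTheory.Sieve
open Summit.Parity.GeneralizedHardyLittlewood.Theorems.AbsoluteUpgrade
open Summit.Parity.GeneralizedHardyLittlewood.Cruxes.AbsoluteUpgrade.NlcCellsAbsoluteClip (roughTuples)
open Summit.Parity.GeneralizedHardyLittlewood.Cruxes.CellParityLaw.SectionAnnihilator (SingularRatio.singularProduct_nonneg)

set_option maxHeartbeats 1600000 in
/-- **Registered stub `stub_sieveTransfer` of the line `SketchIdeator4`** (crux stmt-Parity-14112): sieving out an
arbitrary `±1` weight off the rough tuples of a one-dimensional system — see the module docstring and
`SieveTransfer`. [cite: FriedlanderIwaniecOpera2010, Cor. 6.10] -/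
theorem stub_sieveTransfer : SieveTransfer := by
  intro t L
  obtain ⟨CFL, hCFL0, hFL⟩ := SieveSequence.fundamental_lemma_uniform_holds (2 * ((L + t : ℕ) : ℝ))
    (((2 * (L + t) + 1 : ℕ) : ℝ) ^ (2 * (L + t) + 1) * Real.exp (2 * ((L + t : ℕ) : ℝ) * (9 / 2 + 6 / Real.log 2)))
  refine ⟨2 * CFL, by positivity, fun s hs u hsu => ?_⟩
  -- `u ≥ 4`, exponents
  have hu4 : (4 : ℝ) ≤ u := by linarith
  have hu0 : (0 : ℝ) < u := by linarith
  have hu1 : 1 ≤ u := by exact_mod_cast (show (1 : ℝ) ≤ u by linarith)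
  have he1 : (0 : ℝ) < 1 / u := by positivity
  have he2 : (0 : ℝ) < 2 * s / u := by positivity
  -- thresholds in `N`
  obtain ⟨N₀, hN₀⟩ := Filter.eventually_atTop.mp ((eventually_ge_real 3).and ((eventually_log_ge 1).and
    ((eventually_rpow_ge ((L : ℝ) + 4 * t ^ 2 + t + 2) he1).and ((eventually_rpow_ge 2 he2).and
      (eventually_junk_half t (L + t) (Cj := t + CFL) (Cr := Real.exp (2 * ((L + t : ℕ) : ℝ) * 5))
        (by positivity))))))
  refine ⟨N₀, fun N hN Ψ hΨ hL K hK hKN σ hσ => ?_⟩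
  obtain ⟨hN3, hlog1, hyL, hD2, hjunk⟩ := hN₀ N hN
  -- basic quantities
  have hN1 : (1 : ℝ) ≤ N := by linarith
  have hN0 : (0 : ℝ) < N := by linarith
  have hlog0 : 0 < Real.log N := by linarith
  set y := (N : ℝ) ^ ((1 : ℝ) / u) with hydef
  have ht0 : (0 : ℝ) ≤ 4 * t ^ 2 := by positivity
  have ht0' : (0 : ℝ) ≤ t := Nat.cast_nonneg t
  have hL0 : (0 : ℝ) ≤ L := Nat.cast_nonneg L
  have hy2 : 2 ≤ y := by linarith
  have hy1 : 1 ≤ y := by linarith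
  have hy1' : 1 < y := by linarith
  set zN : ℕ := ⌊y⌋₊ + 1 with hzN
  set z : ℝ := ((zN : ℕ) : ℝ) with hzdef
  have hyz : y < z := by rw [hzdef, hzN]; push_cast; exact Nat.lt_floor_add_one y
  have hz1 : 1 < z := by linarith
  have hz2 : 2 ≤ z := by linarith
  have hz0 : 0 < z := by linarith
  have hlogz : 0 < Real.log z := Real.log_pos hz1
  have haL : ∀ k, ((Ψ k).coeff 0).natAbs ≤ L := fun k => natAbs_coeff_le_of_affLinSize_le hL k 0
  set F := sysPoly Ψ with hF
  have hB : ∀ p : ℕ, p.Prime → polyRootCountMod ![F] p ≤ L + t := fun p hp => rootCount_le_add hΨ haL hp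
  -- the interval
  obtain ⟨m₁, m₂, hI, hcard⟩ := interval_of_convex Ψ hK hKN
  have hImem : ∀ m, m ∈ Finset.Icc m₁ m₂ → m ∈ Finset.Icc (-(N : ℤ)) N ∧ (fun _ : Fin 1 => (m : ℝ)) ∈ K ∧
      ∀ k, 1 ≤ (Ψ k).eval (fun _ => m) := by
    intro m hm
    rw [← hI, Finset.mem_filter] at hm
    exact ⟨hm.1, hm.2.1, hm.2.2⟩
  have hIsub : Finset.Icc m₁ m₂ ⊆ Finset.Icc (-(N : ℤ)) N := fun m hm => (hImem m hm).1
  have hIpos : ∀ m ∈ Finset.Icc m₁ m₂, ∀ k, 1 ≤ (Ψ k).eval (fun _ => m) := fun m hm => (hImem m hm).2.2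
  refine ⟨m₁, m₂, hIsub, hIpos, ?_⟩
  -- non-negativity of the right-hand side
  have hSP0 : 0 ≤ singularProduct Ψ := SingularRatio.singularProduct_nonneg hΨ
  have hAF0 : 0 ≤ archFactor Ψ K := ENNReal.toReal_nonneg
  have hM0 : 0 ≤ archFactor Ψ K * singularProduct Ψ := mul_nonneg hAF0 hSP0
  have hW0 : 0 ≤ (u : ℝ) / Real.log N := by positivity
  have hmain0 : 0 ≤ 2 * CFL * Real.exp (-s) * (archFactor Ψ K * singularProduct Ψ) *
      ((u : ℝ) / Real.log N) ^ t := by positivity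
  have hclass0 : 0 ≤ ∑ d ∈ (Finset.Icc 1 ⌊(N : ℝ) ^ (2 * s / u)⌋₊).filter Squarefree,
      ∑ r ∈ rootsMod (sysPoly Ψ) d,
        |∑ m ∈ (Finset.Icc m₁ m₂).filter (fun m : ℤ => m ≡ (r : ℤ) [ZMOD d]), σ m| :=
    Finset.sum_nonneg fun d _ => Finset.sum_nonneg fun r _ => abs_nonneg _
  have hjunk0 : 0 ≤ (N : ℝ) / Real.log N ^ (t + 1) := by positivity
  -- case 1: a local obstruction below the rough threshold empties the rough tuples
  by_cases hobs : ∃ p : ℕ, p.Prime ∧ polyRootCountMod ![sysPoly Ψ] p = p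
  · obtain ⟨p, hp, hρ⟩ := hobs
    have hpB : p ≤ L + t := by
      have h := rootCount_le_add hΨ haL hp
      rwa [hρ] at h
    have hpy : (p : ℝ) ≤ y := by
      have : (p : ℝ) ≤ (L : ℝ) + t := by exact_mod_cast hpB
      linarith
    -- every residue is a root of `F` modulo `p`, so `p ∣ F(n₀) = ∏ ψ_k(n)` for every `n`
    have hempty : roughTuples Ψ K N u = ∅ := by
      have heq : rootsMod F p = Finset.range p := by
        refine Finset.eq_of_subset_of_card_le (Finset.filter_subset _ _) ?_
        rw [card_rootsMod, hF, hρ, Finset.card_range]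
      have hp' : Prime (p : ℤ) := Nat.prime_iff_prime_int.mp hp
      have hp0 : (p : ℤ) ≠ 0 := by exact_mod_cast hp.ne_zero
      unfold roughTuples
      refine Finset.filter_eq_empty_iff.mpr fun n _ hn => ?_
      set r := (n 0 % p).toNat with hr
      have hrval : ((r : ℕ) : ℤ) = n 0 % p := Int.toNat_of_nonneg (Int.emod_nonneg _ hp0)
      have hrp : r < p := by
        have := Int.emod_lt_of_pos (n 0) (by exact_mod_cast hp.pos : (0 : ℤ) < p)
        omega
      have hrroot : r ∈ rootsMod F p := by rw [heq]; exact Finset.mem_range.mpr hrp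
      have hmod : n 0 ≡ (r : ℤ) [ZMOD p] := by
        rw [hrval, Int.ModEq, Int.emod_emod_of_dvd _ (dvd_refl (p : ℤ))]
      have hdvd : (p : ℤ) ∣ F.eval (n 0) := (dvd_eval_iff_of_modEq F hmod).mpr (mem_rootsMod.mp hrroot).2
      rw [hF, sysPoly_eval] at hdvd
      obtain ⟨k, -, hk⟩ := (hp'.dvd_finsetProd_iff _).mp hdvd
      have hnk : (fun _ : Fin 1 => n 0) = n := funext fun j => by rw [Fin.fin_one_eq_zero j]
      rw [hnk] at hk
      exact RoughTuple.not_rough_of_prime_dvd hp hpy hy2 hk (hn.2 k)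
    rw [hempty, Finset.sum_empty, abs_zero]
    positivity
  -- case 2: off the local obstructions
  push Not at hobs
  have hlt : ∀ p : ℕ, p.Prime → polyRootCountMod ![sysPoly Ψ] p < p := fun p hp =>
    lt_of_le_of_ne (polyRootCountMod_le _ p) (hobs p hp)
  have hdim := hasSieveDimension_sysPoly hΨ haL hlt
  -- step 1: rough tuples ↦ rough points of the interval ↦ sifted points
  rw [sum_roughTuples_eq_sum_filter Ψ hy2 K hI σ]
  have hσabs : ∀ m, |σ m| ≤ 1 := fun m => by rcases hσ m with h | h <;> simp [h]
  have h12 := abs_sum_rough_sub_sum_coprime_le hΨ hIpos hy1 σ hσabs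
  -- step 2: the signed sifted sum (helper file 1)
  set xF : ℝ := ∑ m ∈ Finset.Icc m₁ m₂, ((F.eval m : ℤ) : ℝ) with hxFdef
  have hFpos : ∀ m ∈ Finset.Icc m₁ m₂, 0 < F.eval m := by
    intro m hm
    rw [hF, sysPoly_eval]
    exact Finset.prod_pos fun k _ => lt_of_lt_of_le Int.one_pos (hIpos m hm k)
  have hxF : ∀ m ∈ Finset.Icc m₁ m₂, 0 < F.eval m ∧ ((F.eval m : ℤ) : ℝ) ≤ xF := by
    intro m hm
    refine ⟨hFpos m hm, ?_⟩
    rw [hxFdef]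
    exact Finset.single_le_sum (f := fun m' => ((F.eval m' : ℤ) : ℝ))
      (fun m' hm' => by exact_mod_cast (hFpos m' hm').le) hm
  have hzD : z ≤ z ^ s := Real.self_le_rpow_of_one_le hz1.le hs
  have hsigned := signed_sifted_sum_le_of_sign' hFL hdim (σ := σ) (fun m _ => hσ m) hxF hz2 hzD
  -- step 3: `e^{-log(z^s)/log z} = e^{-s}`
  have hE : Real.exp (-(Real.log (z ^ s) / Real.log z)) = Real.exp (-s) := by
    rw [Real.log_rpow hz0, mul_div_assoc, div_self hlogz.ne', mul_one]
  rw [hE] at hsigned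
  -- step 4: the main term `CFL #I V e^{-s} ≤ 2 CFL e^{-s} (β_∞ ∏β_p) W^t + CFL`
  have hV : ∏ p ∈ Nat.primesBelow ⌈z⌉₊, (1 - (polyRootCountMod ![F] p : ℝ) / p) ≤
      2 * singularProduct Ψ * ((u : ℝ) / Real.log N) ^ t := by
    have h := sieveProduct_floor_succ_le hΨ haL hu1 (N := N) (by linarith)
    rw [hzdef, hzN, hF]
    exact h
  have hVmem := valSeq_densityProduct_mem F ∅ 0 (primesProdBelow z)
  rw [valSeq_densityProduct] at hVmem
  obtain ⟨hV0, hV1⟩ := hVmem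
  have hE0 : 0 ≤ Real.exp (-s) := (Real.exp_pos _).le
  have hE1 : Real.exp (-s) ≤ 1 := by rw [Real.exp_le_one_iff]; linarith
  set V := ∏ p ∈ Nat.primesBelow ⌈z⌉₊, (1 - (polyRootCountMod ![F] p : ℝ) / p) with hVdef
  set W := ((u : ℝ) / Real.log N) ^ t with hWdef
  have hWt0 : 0 ≤ W := pow_nonneg hW0 t
  have hmain : CFL * (#(Finset.Icc m₁ m₂) : ℝ) * V * Real.exp (-s) ≤
      2 * CFL * Real.exp (-s) * (archFactor Ψ K * singularProduct Ψ) * W + CFL := by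
    -- adapted from `Theorems.AbsoluteUpgrade.main_term_le` (sibling line)
    have hC := hCFL0.le
    have h1 : CFL * (#(Finset.Icc m₁ m₂) : ℝ) * V * Real.exp (-s) ≤
        CFL * (archFactor Ψ K + 1) * V * Real.exp (-s) := by
      have := mul_le_mul_of_nonneg_left hcard hC
      have hVE : 0 ≤ V * Real.exp (-s) := mul_nonneg hV0 hE0
      nlinarith
    have h2 : CFL * archFactor Ψ K * V * Real.exp (-s) ≤
        CFL * archFactor Ψ K * (2 * singularProduct Ψ * W) * Real.exp (-s) := by
      have hCA : 0 ≤ CFL * archFactor Ψ K := mul_nonneg hC hAF0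
      have := mul_le_mul_of_nonneg_left hV hCA
      nlinarith
    have h3 : CFL * V * Real.exp (-s) ≤ CFL := by
      calc CFL * V * Real.exp (-s) ≤ CFL * 1 * 1 := by
            have := mul_le_mul hV1 hE1 hE0 zero_le_one
            nlinarith
        _ = CFL := by ring
    nlinarith
  -- step 5: enlarge the level and split off the unit boundary terms
  obtain ⟨hlev, hhalf⟩ := level_facts hs hsu hN1 hy2
  set Dmax : ℕ := ⌊(N : ℝ) ^ (2 * s / u)⌋₊ with hDmax
  have hDmax2 : 2 ≤ Dmax := Nat.le_floor (by exact_mod_cast hD2)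
  have hDmaxN : (Dmax : ℝ) ≤ N := by
    calc (Dmax : ℝ) ≤ (N : ℝ) ^ (2 * s / u) := Nat.floor_le (by positivity)
      _ ≤ (N : ℝ) ^ ((1 : ℝ) / 2) := hhalf
      _ ≤ (N : ℝ) ^ (1 : ℝ) := Real.rpow_le_rpow_of_exponent_le hN1 (by norm_num)
      _ = N := Real.rpow_one _
  have hlev' : ⌊z ^ s⌋₊ ≤ Dmax := by rw [hDmax, hzdef, hzN]; exact hlev
  have hsplit : ∑ d ∈ (Finset.Icc 1 ⌊z ^ s⌋₊).filter Squarefree, ∑ r ∈ rootsMod F d,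
      (1 + |∑ m ∈ (Finset.Icc m₁ m₂).filter (fun m : ℤ => m ≡ (r : ℤ) [ZMOD d]), σ m|) ≤
      ∑ d ∈ (Finset.Icc 1 Dmax).filter Squarefree, ((rootsMod F d).card : ℝ) +
        ∑ d ∈ (Finset.Icc 1 Dmax).filter Squarefree, ∑ r ∈ rootsMod F d,
          |∑ m ∈ (Finset.Icc m₁ m₂).filter (fun m : ℤ => m ≡ (r : ℤ) [ZMOD d]), σ m| := by
    have hsub : (Finset.Icc 1 ⌊z ^ s⌋₊).filter Squarefree ⊆ (Finset.Icc 1 Dmax).filter Squarefree :=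
      Finset.filter_subset_filter _ (Finset.Icc_subset_Icc_right hlev')
    calc _ ≤ ∑ d ∈ (Finset.Icc 1 Dmax).filter Squarefree, ∑ r ∈ rootsMod F d,
          (1 + |∑ m ∈ (Finset.Icc m₁ m₂).filter (fun m : ℤ => m ≡ (r : ℤ) [ZMOD d]), σ m|) :=
          Finset.sum_le_sum_of_subset_of_nonneg hsub fun d _ _ =>
            Finset.sum_nonneg fun r _ => by positivity
      _ = _ := by
          rw [← Finset.sum_add_distrib]
          refine Finset.sum_congr rfl fun d _ => ?_
          rw [Finset.sum_add_distrib, Finset.sum_const, nsmul_eq_mul, mul_one]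
  -- step 6: the unit boundary terms are junk
  have hunits : ∑ d ∈ (Finset.Icc 1 Dmax).filter Squarefree, ((rootsMod F d).card : ℝ) ≤
      Real.exp (2 * ((L + t : ℕ) : ℝ) * 5) * (N : ℝ) ^ ((1 : ℝ) / 2) * Real.log N ^ (2 * (L + t)) := by
    have h1 := sum_card_rootsMod_le hB hDmax2
    have hD2' : (2 : ℝ) ≤ Dmax := by exact_mod_cast hDmax2
    have hlogD : Real.log (Real.log Dmax) ≤ Real.log (Real.log N) := by
      have hlD : 0 < Real.log Dmax := Real.log_pos (by linarith)
      exact Real.log_le_log hlD (Real.log_le_log (by linarith) hDmaxN)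
    have h2 : Real.exp (2 * ((L + t : ℕ) : ℝ) * (Real.log (Real.log Dmax) + 5)) ≤
        Real.exp (2 * ((L + t : ℕ) : ℝ) * 5) * Real.log N ^ (2 * (L + t)) := by
      calc _ ≤ Real.exp (2 * ((L + t : ℕ) : ℝ) * (Real.log (Real.log N) + 5)) := by
            refine Real.exp_le_exp.mpr (mul_le_mul_of_nonneg_left (by linarith) (by positivity))
        _ = Real.exp (2 * ((L + t : ℕ) : ℝ) * 5) *
              Real.exp (((2 * (L + t) : ℕ) : ℝ) * Real.log (Real.log N)) := by
            rw [← Real.exp_add]; congr 1; push_cast; ring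
        _ = Real.exp (2 * ((L + t : ℕ) : ℝ) * 5) * Real.log N ^ (2 * (L + t)) := by
            congr 1
            rw [← Real.rpow_natCast, Real.rpow_def_of_pos hlog0]
            congr 1
            ring
    have hhalf0 : 0 ≤ (N : ℝ) ^ ((1 : ℝ) / 2) := by positivity
    calc _ ≤ (Dmax : ℝ) * Real.exp (2 * ((L + t : ℕ) : ℝ) * (Real.log (Real.log Dmax) + 5)) := by
          have hB' : (((L + t : ℕ) : ℕ) : ℝ) = ((L + t : ℕ) : ℝ) := rfl
          simpa [hB'] using h1
      _ ≤ (N : ℝ) ^ ((1 : ℝ) / 2) * (Real.exp (2 * ((L + t : ℕ) : ℝ) * 5) * Real.log N ^ (2 * (L + t))) :=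
          mul_le_mul ((Nat.floor_le (by positivity)).trans hhalf) h2 (by positivity) hhalf0
      _ = _ := by ring
  -- assembly
  have hfinal := abs_le.mp hsigned
  have h12' := abs_le.mp h12
  have hjunk' : (t : ℝ) + CFL + Real.exp (2 * ((L + t : ℕ) : ℝ) * 5) * (N : ℝ) ^ ((1 : ℝ) / 2) *
      Real.log N ^ (2 * (L + t)) ≤ (N : ℝ) / Real.log N ^ (t + 1) := by
    have := hjunk
    push_cast at this ⊢
    linarith
  rw [abs_le]
  constructor <;> nlinarith [hfinal.1, hfinal.2, h12'.1, h12'.2, hmain, hsplit, hunits, hjunk', hclass0, hmain0]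

end Summit.Parity.GeneralizedHardyLittlewood.Cruxes.PrimeCellsRelative.SieveOutToChowla

end
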